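import Literature.AnabelianGeometry.AbsoluteAnabelian.MLFGaloisSubcategories
import Literature.AnabelianGeometry.AbsoluteAnabelian.MonoidKummerMapsIdRigidProofs

/-!
# [AbsTopIII] Def 3.1 (ii)/(iii): isomorphisms of pairs = `T`-isomorphisms that are Galois-isomorphisms

Proof-only companion (no definitions) of `MLFGaloisSubcategories.lean` (seat abc-iut-L4-t2; S. Mochizuki,
*Topics in absolute anabelian geometry III*, Def. 3.1 (ii)/(iii) p. 67: "if `φ_M` (respectively, `φ_Π`)
is an isomorphism, then we shall refer to `φ` as a `T`-isomorphism (respectively, Galois-isomorphism)";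
the subcategories "determined by the `T`-isomorphisms (respectively, Galois-isomorphisms;
isomorphisms)").  In the typed category of pairs (`GaloisMonoidPair.category`, `MLFGaloisCategories`):

* `GaloisMonoidPair.tIso_of_isIso`, `galoisIso_of_isIso` — an isomorphism is a `T`-isomorphism and a
  Galois-isomorphism;
* `GaloisMonoidPair.isIso_of_tIso_of_galoisIso` — conversely a morphism that is both is an isomorphism
  (its inverse `(φ_Π⁻¹, φ_M⁻¹)` is again a morphism of pairs: `φ_Π` bijective and open is a
  homeomorphism);
* `GaloisMonoidPair.isIso_iff_tIso_and_galoisIso` — so the double-underlined `𝒞^MLF_T` (Mathlib `Core`,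
  `MLFGaloisMonoidPairIsoCat`) is the intersection of `𝒞̲^MLF_T` and the Galois-isomorphism subcategory,
  and its morphisms are w4-d045's structure isomorphisms `GaloisMonoidPair.Iso` (`isoOfCatIso`).

HONEST FRAMING: bookkeeping over OUR kernel definitions; nothing here bears on [IUTchIII] Cor. 3.12.
-/

noncomputable section

universe u

namespace Literature.AnabelianGeometry.AbsoluteAnabelian

open _root_.CategoryTheory

namespace GaloisMonoidPair

variable {P Q : GaloisMonoidPair.{u}}

/-- An isomorphism of the category of pairs is a `T`-isomorphism (`φ_M` bijective).
[cite: MochizukiAbsTopIII2015, Definition 3.1 (ii) p.67] -/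
theorem tIso_of_isIso (φ : P ⟶ Q) [IsIso φ] : tIso φ := by
  rw [tIso_iff]
  have h1 : ∀ x, Hom.homM (inv φ) (Hom.homM φ x) = x := fun x => by
    have := congrArg (fun ψ : P ⟶ P => Hom.homM ψ x) (IsIso.hom_inv_id φ)
    exact this
  have h2 : ∀ y, Hom.homM φ (Hom.homM (inv φ) y) = y := fun y => by
    have := congrArg (fun ψ : Q ⟶ Q => Hom.homM ψ y) (IsIso.inv_hom_id φ)
    exact this
  exact ⟨fun x x' h => by rw [← h1 x, ← h1 x', h], fun y => ⟨_, h2 y⟩⟩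

/-- An isomorphism of the category of pairs is a Galois-isomorphism (`φ_Π` bijective and open: its
inverse `φ_Π⁻¹ = (φ⁻¹)_Π` is continuous). [cite: MochizukiAbsTopIII2015, Definition 3.1 (ii) p.67] -/
theorem galoisIso_of_isIso (φ : P ⟶ Q) [IsIso φ] : galoisIso φ := by
  rw [galoisIso_iff]
  have h1 : ∀ g, Hom.homPi (inv φ) (Hom.homPi φ g) = g := fun g => by
    have := congrArg (fun ψ : P ⟶ P => Hom.homPi ψ g) (IsIso.hom_inv_id φ)
    exact this
  have h2 : ∀ g, Hom.homPi φ (Hom.homPi (inv φ) g) = g := fun g => by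
    have := congrArg (fun ψ : Q ⟶ Q => Hom.homPi ψ g) (IsIso.inv_hom_id φ)
    exact this
  let e : P.Pi ≃ₜ Q.Pi :=
    { toFun := Hom.homPi φ
      invFun := Hom.homPi (inv φ)
      left_inv := h1
      right_inv := h2
      continuous_toFun := Hom.continuous_homPi φ
      continuous_invFun := Hom.continuous_homPi (inv φ) }
  exact ⟨e.bijective, e.isOpenMap⟩

/-- **A `T`-isomorphism that is a Galois-isomorphism is an isomorphism of pairs**: the inverse
`(φ_Π⁻¹, φ_M⁻¹)` is a morphism of pairs (via the structure isomorphism it determines and w4-d045's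
`Iso.toCatIso`). [cite: MochizukiAbsTopIII2015, Definition 3.1 (iii) p.67] -/
theorem isIso_of_tIso_of_galoisIso (φ : P ⟶ Q) (hT : tIso φ) (hG : galoisIso φ) : IsIso φ := by
  rw [tIso_iff] at hT
  rw [galoisIso_iff] at hG
  -- the structure isomorphism with components `φ_Π`, `φ_M`
  let ePi : P.Pi ≃ₜ* Q.Pi :=
    { (Equiv.ofBijective _ hG.1).toHomeomorphOfContinuousOpen (Hom.continuous_homPi φ) hG.2 with
      map_mul' := fun g h => map_mul (Hom.homPi φ) g h }
  let e : GaloisMonoidPair.Iso P Q :=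
    { isoPi := ePi
      isoM := MulEquiv.ofBijective (Hom.homM φ) hT
      smul_comm := fun g x => Hom.smul_comm φ g x }
  have he : e.toCatIso.hom = φ := GaloisMonoidPair.Hom.ext rfl rfl
  rw [← he]
  infer_instance

/-- **Isomorphisms = `T`-isomorphisms ∩ Galois-isomorphisms** in the category of pairs (so the
double-underlined `𝒞^MLF_T` of Def 3.1 (iii) is the intersection of `𝒞̲^MLF_T` and the
Galois-isomorphism subcategory). [cite: MochizukiAbsTopIII2015, Definition 3.1 (iii) p.67] -/
theorem isIso_iff_tIso_and_galoisIso (φ : P ⟶ Q) : IsIso φ ↔ tIso φ ∧ galoisIso φ :=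
  ⟨fun _ => ⟨tIso_of_isIso φ, galoisIso_of_isIso φ⟩, fun h => isIso_of_tIso_of_galoisIso φ h.1 h.2⟩

end GaloisMonoidPair

end Literature.AnabelianGeometry.AbsoluteAnabelian

end
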